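/-
Copyright: statement-level skeleton of a published paper (lit-balaban cell, Phase-2 proof seat p13, gen 3). No proof
claims beyond what the kernel checks below.
-/
import Literature.MathematicalPhysics.QuantumFieldTheory.Balaban1983to89.B4Sect5CubeBounds

/-!
# `Balaban1983to89.B4Sect5WalkDecay` — T. Bałaban, *Regularity and decay of lattice Green's functions*, Commun.
Math. Phys. **89** (1983) 571–597 [Balaban1983RegularityDecay] (= B4), Sect. 5, pp. 595–596 [PDF 25–26]:
**(5.18)–(5.21) ⇒ (5.7) ALONG THE PRINTED GENERALIZED RANDOM WALK** — the entrywise estimate of `C_Λ = A_Λ^{−1}`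
from the walk expansion (5.17), with the `L²` operator norms of the print (`‖h_jC_jh_j‖ ≤ γ₀^{−1}`,
`‖R_{j,j′}‖ ≤ αe^{−δ₂|j−j′|}`), the convolution bound (5.20) and the choice of `M` (5.21)

statement-level skeleton of published theorems with citation tags; proofs where landed; nothing here is a claim
about the Yang–Mills mass gap

PDF held: `paper:balaban1983-cmp89-regularity-decay` (journal page = PDF page + 570); page renders
`run/shared/lean/pub/pub-balaban/b2b-balaban-ref1/pages/1983-cmp89-regularity-decay/…-p025/026-x2.png`; verbatim
text from the cell transcript `run/shared/lean/pub/pub-balaban/b2b-balaban-b04/transcript-B4.md` ll. 351–386.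

CITATION HEADER (lean-in-tree rule).  Part of the lit-balaban TYPED SKELETON (HOME `run/shared/lean/pub/lit-balaban/`):
WHAT IS REPRODUCED = row **B4.Eq5.15** of `HOME/lit-balaban-r01/ROWS-B4.md`, members **(5.18), (5.20), (5.21)** and
the conclusion **(5.7)** they prove (the row's cell reads «(5.18)–(5.27) absent as displays — conclusions = Sect. 5
Theorem proved by `B4Sect5Proof` via finite Combes–Thomas»; INTERFACES §3 row F-T4-410: the NE spine cites B4
(5.19)–(5.24)).  Unit `lit-balaban-p13` (gen 3); owner r01; referee ref-4.  Third file of the seat's Sect.-5 chain: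
`B4Sect5RandomWalk` (p244548: (5.11)–(5.14), (5.16)–(5.17) for an abstract cube system) and `B4Sect5CubeBounds`
(p245229/p245700: the cube system BUILT on `ℤ^d`, (5.15) in `ℓ^∞` and `L²`, the lattice instance
`hasSum517_lattice'` of (5.17)) are IMPORTED and used by name; nothing landed is edited.

THE PRINTED TEXT (verbatim, p. 595–596 [PDF 25–26]).  *"Let us now prove (5.7). We have
|C_Λ(x,x′)| ≤ Σ_{ω: x∈□_{ω₀}, x′∈□_{ω_{2n}}} |⟨δ_x, h_{ω₀}C_{ω₀}…R_{ω_{2n−1},ω_{2n}}C_{ω_{2n}}h_{ω_{2n}}δ_{x′}⟩|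
≤ Σ′_ω γ₀^{−(n+1)}αⁿ e^{−δ₂|ω₁−ω₂|}·…·e^{−δ₂|ω_{2n−1}−ω_{2n}|}
≤ Σ_{j,j′: x∈□_j, x′∈□_{j′}} [Σ_{n=1}^∞ γ₀^{−(n+1)}αⁿ(e^{dδ₂})ⁿ Σ_{j₁,…,j_{2n−1}∈Z^d} e^{−δ₂|j−j₁|}·…·e^{−δ₂|j_{2n−1}−j′|}
+ γ₀^{−1}e^{dδ₂}e^{−δ₂|j−j′|}]. (5.18)  To investigate the sums above, it is convenient to take the absolute value |j|
defined by |j| = Σ_μ|j_μ|; then the sum over j's factorizes into sums over components. If we define g₁(j) = e^{−δ₂|j|},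
j ∈ Z, then the sum over j's in (5.18) can be written as Π_μ g_{2n}(j_μ − j′_μ), g_{2n} = g₁*…*g₁ is a convolution of
2n functions g₁. The Fourier transform of g₁ is equal to Σ_{j∈Z} e^{−ipj}e^{−δ₂|j|} = … , so we have
g_n(j) = (1/2π)∫_{−π}^{π} dp e^{ijp}(1−e^{−2δ₂})ⁿ/((1−e^{−ip}e^{−δ₂})ⁿ(1−e^{ip}e^{−δ₂})ⁿ), g_n(j) = g_n(|j|), (5.19)
and from this we obtain |g_n(j)| ≤ c₂ⁿe^{−½δ₂|j|}, for some c₂. (5.20)  Finally we fix M such that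
γ₀^{−1}αe^{dδ₂}c₂^{2d} < 1, and we get |C_Λ(x,x′)| ≤ Σ_{j,j′: x∈□_j, x′∈□_{j′}} γ₀^{−1}e^{dδ₂}(1 − γ₀^{−1}e^{dδ₂}c₂^{2d}α)^{−1}
e^{−½δ₂|j−j′|} ≤ c₁e^{−½δ₂M^{−1}|x−x′|}. (5.21)  This inequality implies (5.7) with δ₁ = ½δ₂M^{−1}."*

THE TYPING (what is proved, and not more).
* SETTING = that of `B4Sect5CubeBounds`: a finite `Λ ⊂ ℤ^d`, the operator `A` on `L²(Λ; ℝ^N)` (the print's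
  `A_Λ`, index type `B4.Idx Λ N`) with (5.6) in the tree's form `B4.Hyp56 Λ A γ₀ c₀ δ₀`; cubes of size `M`
  (`labels`, `pFam`, `hFam`, `cFam`); `|x − x′|` = the sup-distance of `ℤ^d` (as in `B4`); `δ₂ = ¼δ₀` (the print's
  *"e.g. δ₂ = ¼δ₀"*, fixed by `B4Sect5CubeBounds.ineq515_l2`), `α = alpha515 d N c₀ δ₀ M`.
* NORMS.  The print's `‖·‖` is the `L²` OPERATOR NORM; it is used here through Mathlib's scoped instance
  `Matrix.Norms.L2Operator` (`Matrix.instL2OpNormedRing`, the norm of `Matrix.toEuclideanCLM`): entries are bounded by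
  the norm (`abs_entry_le_l2norm`), *"‖C_{j′}‖ ≤ γ₀^{−1}"* follows from `A ≥ γ₀I` ALONE (`l2norm_cFam_le`, via
  `QGQInverse.inv_mulVec_sq_le` on the compressions `A_{□_j}`, `B6GOmega.hyp56_compress`) — NOT from a decay
  estimate of the local inverses —, `‖h_j‖ ≤ 1` (`l2norm_hFam_le`) and (5.15) `‖R_{j,j′}‖ ≤ αe^{−δ₂|j−j′|}`
  (`l2norm_rPair_le` = `ineq515_l2`).  The walk expansion itself is the HasSum `hasSum517_lattice'` (stated in the
  `ℓ^∞` normed ring; a `HasSum` of matrices is entrywise — the topology is the product topology for both norms), so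
  its largeness hypotheses `M ≥ 5`, `M > K_R`, `M > Θ₁` are carried.
* (5.18): the FIRST inequality is `abs_inv_apply_le_tsum_abs` (entrywise `|C_Λ(x,x′)| ≤ Σ_ω|term_ω(x,x′)|`, terms
  vanish unless `x ∈ □_{ω₀}`, `x′ ∈ □_{ω_{2n}}`: `walkTerm_apply_eq_zero_left/right`); the SECOND (`γ₀^{−(n+1)}αⁿ
  Πe^{−δ₂|ω_{2i−1}−ω_{2i}|}`) is `norm_walkTerm_le`; the THIRD (adjacent steps absorbed by `e^{dδ₂}` per step and the
  chain completed to `2n` exponential steps) is folded into the level estimate `level_abs_sum_le`, with `e^{δ₂/2}` per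
  step (sup-distance adjacency `max_μ|ω_{2i,μ}−ω_{2i+1,μ}| ≤ 1` costs `1`, not `d`, in the sup metric).
* (5.19)–(5.20): the Fourier representation (5.19) of the convolution `g_n` is NOT reproduced.  The bound it serves,
  (5.20) *"|g_n(j)| ≤ c₂ⁿe^{−½δ₂|j|}"*, is proved in the ELEMENTARY form used since: split every factor
  `e^{−δ₂|·|} = e^{−½δ₂|·|}e^{−½δ₂|·|}`, collect one half along the chain by the triangle inequality into
  `e^{−½δ₂|j−j′|}`, and sum the other half factor by factor (`B4Sect5Proof.latticeSum_le`, constant `K_d(δ₂/2)` per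
  step) — this is the abstract weighted Schur line `weighted_level_exp_le` (an exponential weight `e^{½δ₂ d(l,ω_end)}`
  carried through `B4Sect5RandomWalk.weighted_level_le`'s induction), so `c₂` ↔ `3^dK_d(δ₀/8)` (the `3^d` =
  successors allowed by (5.17), `B4Sect5CubeBounds.card_filter_adj_le`).  DIVERGENCE (method, not statement): the
  print's `|j| = Σ_μ|j_μ|` and coordinatewise factorization are replaced by the sup-distance throughout; constants
  differ, the statement (5.7) does not.
* (5.21) and *"This inequality implies (5.7) with δ₁ = ½δ₂M^{−1}"*: `abs_inv_apply_le_of_walk` — for every cube size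
  `M` with the expansion hypotheses and `θ_W(M) = 3^dK_d(δ₀/8)e^{δ₀/8}αγ₀^{−1} < 1` (*"we fix M such that
  γ₀^{−1}αe^{dδ₂}c₂^{2d} < 1"*): `|A_Λ^{−1}(x,x′)| ≤ 2^dγ₀^{−1}e^{δ₀/4}(1 − θ_W)^{−1}·e^{−(δ₀/(8M))|x−x′|}` (`2^d` = cubes
  through `x`, `B4Sect5CubeBounds.card_filter_inBox_le`; `e^{δ₀/4}` = `B4.walk_to_distance`'s `e^{d′δ₂}` with
  `d′ = 1`; `δ₁ = δ₂/(2M) = δ₀/(8M)`).  `thetaW_le`: `θ_W(M) ≤ Θ_W/M`.  **`concl57_walk`**: hence constants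
  `c₁ = 2^{d+1}γ₀^{−1}e^{δ₀/4}`, `δ₁ = δ₀/(8M₁)` with `M₁ = M₁(d,N,γ₀,c₀,δ₀)` — *"The constants δ₁, c₁ are functions of
  δ₀, γ₀, c₀"* (p. 597) — valid for EVERY finite `Λ` and every `A` with (5.6); **`concl57_compress_walk`**: the
  printed form *"for arbitrary Λ ⊂ Ω and for C_Λ = A_Λ^{−1}"* (first clause of `B4.Concl57_58`, via
  `B6GOmega.hyp56_compress`).
* NOT HERE: (5.22)–(5.23) (⇒ (5.8)) and (5.24)–(5.27) (⇒ (5.10)); (5.19).  The tree's `B4Sect5Proof` proves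
  (5.7)–(5.10) by its own route; this file certifies the PRINTED route to (5.7).  No `def` is introduced (constants
  are written out; `θ_W`, `Θ_W` above are abbreviations of this docstring only).
-/

namespace Literature.MathematicalPhysics.QuantumFieldTheory.Balaban1983to89.B4Sect5WalkDecay

open scoped BigOperators
open Finset Matrix

/-! ## §0 The `L²` operator norm of the print: entries and quadratic bounds -/

section L2Toolkit

open scoped Matrix.Norms.L2Operator

variable {n : Type*} [Fintype n] [DecidableEq n]

/-- `L²` operator norm from a quadratic bound: `Σ_i (Tφ)_i² ≤ K²Σ_i φ_i²` for all `φ` gives `‖T‖ ≤ K` (the norm of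
p. 595, *"the norms of the operators R_{j,j′}"*, is the `L²(Λ) → L²(Λ)` operator norm). [cite:
Balaban1983RegularityDecay, (5.15) p.595] -/
theorem l2norm_le_of_sq (T : Matrix n n ℝ) {K : ℝ} (hK : 0 ≤ K)
    (h : ∀ φ : n → ℝ, ∑ i, (T *ᵥ φ) i ^ 2 ≤ K ^ 2 * ∑ i, φ i ^ 2) : ‖T‖ ≤ K := by
  rw [Matrix.cstar_norm_def]
  refine ContinuousLinearMap.opNorm_le_bound _ hK fun x => ?_
  have hx : ‖x‖ ^ 2 = ∑ i, (WithLp.ofLp x) i ^ 2 := by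
    rw [EuclideanSpace.norm_sq_eq]
    simp [Real.norm_eq_abs, sq_abs]
  have hTx : ‖Matrix.toEuclideanCLM (n := n) (𝕜 := ℝ) T x‖ ^ 2 = ∑ i, (T *ᵥ WithLp.ofLp x) i ^ 2 := by
    rw [EuclideanSpace.norm_sq_eq]
    simp [Real.norm_eq_abs, sq_abs, Matrix.ofLp_toEuclideanCLM]
  have h1 : ‖Matrix.toEuclideanCLM (n := n) (𝕜 := ℝ) T x‖ ^ 2 ≤ (K * ‖x‖) ^ 2 := by
    rw [hTx, mul_pow, hx]; exact h _
  exact (pow_le_pow_iff_left₀ (norm_nonneg _) (mul_nonneg hK (norm_nonneg _)) two_ne_zero).mp h1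

/-- *"|⟨δ_x, T δ_{x′}⟩|"* ≤ `‖T‖`: a kernel entry is bounded by the `L²` operator norm (first inequality of (5.18)).
[cite: Balaban1983RegularityDecay, (5.18) p.595] -/
theorem abs_entry_le_l2norm (T : Matrix n n ℝ) (i j : n) : |T i j| ≤ ‖T‖ := by
  have h1 : ‖Matrix.toEuclideanCLM (n := n) (𝕜 := ℝ) T (PiLp.single 2 j (1:ℝ) : EuclideanSpace ℝ n)‖ ≤ ‖T‖ := by
    refine (ContinuousLinearMap.le_opNorm _ _).trans ?_
    rw [PiLp.norm_single, norm_one, mul_one, Matrix.cstar_norm_def]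
  have h2 : |T i j| ≤
      ‖Matrix.toEuclideanCLM (n := n) (𝕜 := ℝ) T (PiLp.single 2 j (1:ℝ) : EuclideanSpace ℝ n)‖ := by
    have h3 := PiLp.norm_apply_le
      (Matrix.toEuclideanCLM (n := n) (𝕜 := ℝ) T (PiLp.single 2 j (1:ℝ) : EuclideanSpace ℝ n)) i
    rw [Real.norm_eq_abs] at h3
    convert h3 using 2
    change T i j = WithLp.ofLp (Matrix.toEuclideanCLM (n := n) (𝕜 := ℝ) T
      (PiLp.single 2 j (1:ℝ) : EuclideanSpace ℝ n)) i
    rw [Matrix.ofLp_toEuclideanCLM, PiLp.ofLp_single]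
    simp [Matrix.mulVec, dotProduct, Pi.single_apply]
  exact h2.trans h1

end L2Toolkit

/-! ## §1 The weighted Schur line behind (5.18)/(5.20): an exponential weight on the end label of the walk -/

section Abstract

open Literature.MathematicalPhysics.QuantumFieldTheory.Balaban1983to89
open B4RandomWalk213 B4Sect5RandomWalk

variable {R : Type*} [NormedRing R] {J : Type*} [Fintype J]

/-- **THE CONVOLUTION STEP OF (5.18)–(5.20), abstract form.**  Pair factors `b (l,l′)` (the `R_{l,l′}C_{l′}h_{l′}` of
(5.17)) with the locality of (5.17) (`hbb`) and the weighted successor bound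
`Σ_{(l₁,l′): l ~ l₁} e^{ε(1 + d(l₁,l′))}‖b (l₁,l′)‖ ≤ θ` give, for every left factor `x` ending at `l`,
`Σ_{ys} e^{ε·d(l, ω_end)}‖x·b(ys 0)⋯b(ys (n−1))‖ ≤ ‖x‖θⁿ` — i.e. the sum over the `2n − 1` intermediate labels of
*"e^{−δ₂|j−j₁|}·…·e^{−δ₂|j_{2n−1}−j′|}"* with the weight `e^{ε d(j,j′)}` retained costs a constant per step
((5.20) *"|g_n(j)| ≤ c₂ⁿe^{−½δ₂|j|}"*, elementary route: `d(l,end) ≤ d(l,l₁) + d(l₁,l′) + d(l′,end) ≤ 1 + …`).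
`d` is any pseudo-distance on the labels with `d ≤ 1` on adjacent pairs. [cite: Balaban1983RegularityDecay,
(5.18)–(5.20) pp.595–596] -/
theorem weighted_level_exp_le (adj : J → J → Prop) [DecidableRel adj] (dJ : J → J → ℝ)
    (hself : ∀ a, dJ a a = 0) (htri : ∀ a b c, dJ a c ≤ dJ a b + dJ b c) (hadj : ∀ a b, adj a b → dJ a b ≤ 1)
    {b : J × J → R} {ε θ : ℝ} (hε : 0 ≤ ε)
    (hbb : ∀ q q' : J × J, ¬ adj q.2 q'.1 → b q * b q' = 0)
    (hθ : ∀ l : J, ∑ q ∈ Finset.univ.filter (fun q : J × J => adj l q.1),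
      Real.exp (ε * (1 + dJ q.1 q.2)) * ‖b q‖ ≤ θ) :
    ∀ (n : ℕ) (l : J) (x : R), (∀ q : J × J, ¬ adj l q.1 → x * b q = 0) →
      ∑ ys : Fin n → J × J, Real.exp (ε * dJ l (lastPt l n (fun i => (ys i).2))) * ‖x * bprod b n ys‖ ≤
        ‖x‖ * θ ^ n := by
  intro n
  induction n with
  | zero =>
      intro l x _
      simp [hself]
  | succ n ih =>
      intro l x hx
      have hθ0 : 0 ≤ θ := le_trans (Finset.sum_nonneg fun _ _ => by positivity) (hθ l)
      rw [sum_tuple_succ]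
      simp only [bprod_cons]
      have hlast : ∀ (q : J × J) (ys : Fin n → J × J),
          lastPt l (n + 1) (fun i => ((Fin.cons q ys : Fin (n + 1) → J × J) i).2) =
            lastPt q.2 n (fun i => (ys i).2) := by
        intro q ys
        have : (fun i => ((Fin.cons q ys : Fin (n + 1) → J × J) i).2) =
            (Fin.cons q.2 (fun i => (ys i).2) : Fin (n + 1) → J) := by
          funext i; refine Fin.cases ?_ (fun k => ?_) i <;> simp
        rw [this, lastPt_cons]
      simp only [hlast]
      calc ∑ q, ∑ ys : Fin n → J × J,
            Real.exp (ε * dJ l (lastPt q.2 n fun i => (ys i).2)) * ‖x * (b q * bprod b n ys)‖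
          ≤ ∑ q, ∑ ys : Fin n → J × J, (Real.exp (ε * (1 + dJ q.1 q.2)) *
              (Real.exp (ε * dJ q.2 (lastPt q.2 n fun i => (ys i).2)) * ‖(x * b q) * bprod b n ys‖)) := by
            refine Finset.sum_le_sum fun q _ => Finset.sum_le_sum fun ys _ => ?_
            by_cases hq : adj l q.1
            · rw [← mul_assoc, ← mul_assoc, ← Real.exp_add]
              apply mul_le_mul_of_nonneg_right _ (norm_nonneg _)
              apply Real.exp_le_exp.mpr
              have h1 := htri l q.1 (lastPt q.2 n fun i => (ys i).2)
              have h2 := htri q.1 q.2 (lastPt q.2 n fun i => (ys i).2)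
              have h3 := hadj l q.1 hq
              nlinarith
            · rw [← mul_assoc x, hx q hq, zero_mul, norm_zero, mul_zero, mul_zero, mul_zero]
        _ = ∑ q, Real.exp (ε * (1 + dJ q.1 q.2)) * ∑ ys : Fin n → J × J,
              Real.exp (ε * dJ q.2 (lastPt q.2 n fun i => (ys i).2)) * ‖(x * b q) * bprod b n ys‖ := by
            simp only [Finset.mul_sum]
        _ ≤ ∑ q, Real.exp (ε * (1 + dJ q.1 q.2)) * (‖x * b q‖ * θ ^ n) :=
            Finset.sum_le_sum fun q _ => mul_le_mul_of_nonneg_left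
              (ih q.2 (x * b q) (fun q' hq' => by rw [mul_assoc, hbb q q' hq', mul_zero])) (by positivity)
        _ = (∑ q, Real.exp (ε * (1 + dJ q.1 q.2)) * ‖x * b q‖) * θ ^ n := by
            rw [Finset.sum_mul]; refine Finset.sum_congr rfl fun q _ => ?_; ring
        _ = (∑ q ∈ Finset.univ.filter (fun q : J × J => adj l q.1),
              Real.exp (ε * (1 + dJ q.1 q.2)) * ‖x * b q‖) * θ ^ n := by
            congr 1
            refine (Finset.sum_subset (Finset.subset_univ _) fun q _ hq => ?_).symm
            have hq' : ¬ adj l q.1 := fun h' => hq (Finset.mem_filter.mpr ⟨Finset.mem_univ q, h'⟩)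
            rw [hx q hq', norm_zero, mul_zero]
        _ ≤ (∑ q ∈ Finset.univ.filter (fun q : J × J => adj l q.1),
              Real.exp (ε * (1 + dJ q.1 q.2)) * (‖x‖ * ‖b q‖)) * θ ^ n :=
            mul_le_mul_of_nonneg_right (Finset.sum_le_sum fun q _ =>
              mul_le_mul_of_nonneg_left (norm_mul_le _ _) (by positivity)) (pow_nonneg hθ0 n)
        _ = ‖x‖ * (∑ q ∈ Finset.univ.filter (fun q : J × J => adj l q.1),
              Real.exp (ε * (1 + dJ q.1 q.2)) * ‖b q‖) * θ ^ n := by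
            rw [Finset.mul_sum]; congr 1; refine Finset.sum_congr rfl fun q _ => ?_; ring
        _ ≤ ‖x‖ * θ * θ ^ n :=
            mul_le_mul_of_nonneg_right (mul_le_mul_of_nonneg_left (hθ l) (norm_nonneg _)) (pow_nonneg hθ0 n)
        _ = ‖x‖ * θ ^ (n + 1) := by ring

/-- *"γ₀^{−(n+1)}αⁿ e^{−δ₂|ω₁−ω₂|}·…·e^{−δ₂|ω_{2n−1}−ω_{2n}|}"* — the norm of a walk term is at most the product of
the norm bounds of its factors (second inequality of (5.18), abstract form: `‖a_j·b(ys 0)⋯b(ys (n−1))‖ ≤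
‖a_j‖·Π_i β(ys i)`). [cite: Balaban1983RegularityDecay, (5.18) p.595] -/
theorem norm_mul_bprod_le_prod {ι : Type*} {b : ι → R} {β : ι → ℝ} (hβ : ∀ i, ‖b i‖ ≤ β i) :
    ∀ (n : ℕ) (x : R) (ys : Fin n → ι), ‖x * bprod b n ys‖ ≤ ‖x‖ * ∏ i, β (ys i) := by
  intro n
  induction n with
  | zero => intro x ys; simp
  | succ n ih =>
      intro x ys
      rw [bprod_succ, ← mul_assoc, Fin.prod_univ_succ]
      calc ‖x * b (ys 0) * bprod b n (Fin.tail ys)‖ ≤ ‖x * b (ys 0)‖ * ∏ i : Fin n, β (Fin.tail ys i) := ih _ _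
        _ ≤ ‖x‖ * β (ys 0) * ∏ i : Fin n, β (Fin.tail ys i) :=
            mul_le_mul_of_nonneg_right
              ((norm_mul_le _ _).trans (mul_le_mul_of_nonneg_left (hβ _) (norm_nonneg _)))
              (Finset.prod_nonneg fun i _ => (norm_nonneg _).trans (hβ _))
        _ = ‖x‖ * (β (ys 0) * ∏ i : Fin n, β (ys i.succ)) := by rw [mul_assoc]; rfl

end Abstract


/-! ## §2 The `L²` bounds of p. 595 on `L²(Λ; ℝ^N)`: `‖h_j‖ ≤ 1`, `‖C_j‖ ≤ γ₀^{−1}`, (5.15) -/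

section LatticeNorms

open Literature.MathematicalPhysics.QuantumFieldTheory.Balaban1983to89
open B4Commutators25to211 B4Sect5RandomWalk B4Sect5Proof B6GOmega B4Sect5CubeBounds B4RandomWalk213
open scoped Matrix.Norms.L2Operator

variable {d N : ℕ} {Λ : Finset (Fin d → ℤ)} {γ₀ c₀ δ₀ : ℝ}

/-- `(hφ)(x) = h(x)φ(x)` for the multiplication operator `mulH h`. [cite: Balaban1983RegularityDecay, (5.12) p.594] -/
theorem mulH_mulVec_apply {X ι : Type*} [Fintype X] [Fintype ι] [DecidableEq X] [DecidableEq ι] (f : X → ℝ)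
    (φ : X × ι → ℝ) (p : X × ι) : (mulH (ι := ι) f *ᵥ φ) p = f p.1 * φ p := by
  simp only [Matrix.mulVec, dotProduct, mulH_apply]
  rw [Finset.sum_eq_single p]
  · simp
  · intro q _ hq; simp [Ne.symm hq]
  · intro h; exact absurd (Finset.mem_univ p) h

/-- a multiplication operator by a function with `|h| ≤ 1` has `L²` operator norm `≤ 1`. [cite:
Balaban1983RegularityDecay, (5.12) p.594] -/
theorem l2norm_mulH_le {X ι : Type*} [Fintype X] [Fintype ι] [DecidableEq X] [DecidableEq ι] {f : X → ℝ}
    (hf : ∀ x, |f x| ≤ 1) : ‖mulH (ι := ι) f‖ ≤ 1 := by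
  refine l2norm_le_of_sq _ zero_le_one fun φ => ?_
  rw [one_pow, one_mul]
  refine Finset.sum_le_sum fun p _ => ?_
  rw [mulH_mulVec_apply, mul_pow]
  have h1 : f p.1 ^ 2 ≤ 1 := by
    have := hf p.1
    rw [← sq_abs]; nlinarith [abs_nonneg (f p.1)]
  nlinarith [sq_nonneg (φ p)]

/-- `‖h_j‖ ≤ 1` in the `L²` operator norm (`0 ≤ h_j ≤ 1`). [cite: Balaban1983RegularityDecay, (5.12) p.594; (5.18)
p.595] -/
theorem l2norm_hFam_le (M : ℕ) (j : ↥(labels M Λ)) : ‖hFam N M Λ j‖ ≤ 1 :=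
  l2norm_mulH_le fun _ => abs_hfun_le_one M _ _

/-- `(ιᵀφ)(k) = φ(ι k)`: restriction to a sub-domain. [cite: Balaban1983RegularityDecay, Sect. 5 Theorem p.594
(A_Λ = ΛAΛ)] -/
theorem transpose_inclMatrix_mulVec {Λ' : Finset (Fin d → ℤ)} (h : Λ' ⊆ Λ) (φ : B4.Idx Λ N → ℝ)
    (k : B4.Idx Λ' N) : ((inclMatrix (N := N) h)ᵀ *ᵥ φ) k = φ (B4.inclIdx h k) := by
  simp only [Matrix.mulVec, dotProduct, Matrix.transpose_apply, inclMatrix_apply]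
  rw [Finset.sum_eq_single (B4.inclIdx h k)]
  · simp
  · intro p _ hp; simp [hp]
  · intro h0; exact absurd (Finset.mem_univ _) h0

/-- `‖ιᵀφ‖₂² ≤ ‖φ‖₂²`: restriction does not increase the `L²` norm. [cite: Balaban1983RegularityDecay, Sect. 5
Theorem p.594 (A_Λ = ΛAΛ)] -/
theorem sum_sq_transpose_inclMatrix_mulVec_le {Λ' : Finset (Fin d → ℤ)} (h : Λ' ⊆ Λ) (φ : B4.Idx Λ N → ℝ) :
    ∑ k, ((inclMatrix (N := N) h)ᵀ *ᵥ φ) k ^ 2 ≤ ∑ p, φ p ^ 2 := by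
  simp only [transpose_inclMatrix_mulVec]
  rw [sum_inclIdx h (fun p => φ p ^ 2)]
  exact Finset.sum_le_sum fun p _ => by
    split_ifs
    · exact le_rfl
    · exact sq_nonneg _

/-- **`‖C_j‖ ≤ γ₀^{−1}`** p. 595, verbatim: *"‖R‖ ≤ max{sup_jΣ_{j′}‖R_{j,j′}‖, sup_{j′}Σ_j‖R_{j,j′}‖}γ₀^{−1}"* — the
factor `γ₀^{−1}` is the `L²` bound of `C_{j′} = A_{□_{j′}}^{−1}`, from the FIRST clause `A ≥ γ₀I` of (5.6) only: the
compression `A_{□_j}` is again `≥ γ₀I` (`B6GOmega.hyp56_compress`) and a coercive symmetric matrix has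
`γ₀²‖S^{−1}y‖² ≤ ‖y‖²` (`QGQInverse.inv_mulVec_sq_le`). [cite: Balaban1983RegularityDecay, (5.6) p.594; p.595] -/
theorem l2norm_cOp_le (hγ : 0 < γ₀) (hc : 0 ≤ c₀) (hδ : 0 < δ₀) {A : Matrix (B4.Idx Λ N) (B4.Idx Λ N) ℝ}
    (hA : B4.Hyp56 Λ A γ₀ c₀ δ₀) (M : ℕ) (j : Fin d → ℤ) : ‖cOp M A j‖ ≤ γ₀⁻¹ := by
  have hcoe : QGQInverse.Coercive (B4.compress (boxSet_subset M Λ j) A) γ₀ :=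
    coercive_of_hyp56 (hyp56_compress _ hγ.le hc hδ.le hA)
  refine l2norm_le_of_sq _ (inv_nonneg.mpr hγ.le) fun φ => ?_
  set ι := inclMatrix (N := N) (boxSet_subset M Λ j) with hι
  set B := B4.compress (boxSet_subset M Λ j) A with hB
  set w := ιᵀ *ᵥ φ with hw
  have e : cOp M A j *ᵥ φ = ι *ᵥ (B⁻¹ *ᵥ w) := by
    rw [cOp, ← hι, ← hB, hw, Matrix.mulVec_mulVec, Matrix.mulVec_mulVec]
  rw [e, inclMatrix_normSq]
  have h1 := QGQInverse.inv_mulVec_sq_le hγ hcoe w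
  have h2 := sum_sq_transpose_inclMatrix_mulVec_le (N := N) (boxSet_subset M Λ j) φ
  rw [← hι, ← hw] at h2
  have e1 : (B⁻¹ *ᵥ w) ⬝ᵥ (B⁻¹ *ᵥ w) = ∑ k, (B⁻¹ *ᵥ w) k ^ 2 := by simp [dotProduct, pow_two]
  have e2 : w ⬝ᵥ w = ∑ k, w k ^ 2 := by simp [dotProduct, pow_two]
  rw [e1, e2] at h1
  have hγ2 : 0 < γ₀ ^ 2 := by positivity
  rw [inv_pow, ← div_eq_inv_mul, le_div_iff₀ hγ2]
  calc (∑ k, (B⁻¹ *ᵥ w) k ^ 2) * γ₀ ^ 2 = γ₀ ^ 2 * ∑ k, (B⁻¹ *ᵥ w) k ^ 2 := by ring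
    _ ≤ ∑ k, w k ^ 2 := h1
    _ ≤ ∑ p, φ p ^ 2 := h2

/-- `‖C_j‖ ≤ γ₀^{−1}` for the family `C_j`, `j ∈ labels`. [cite: Balaban1983RegularityDecay, p.595] -/
theorem l2norm_cFam_le (hγ : 0 < γ₀) (hc : 0 ≤ c₀) (hδ : 0 < δ₀) {A : Matrix (B4.Idx Λ N) (B4.Idx Λ N) ℝ}
    (hA : B4.Hyp56 Λ A γ₀ c₀ δ₀) (M : ℕ) (j : ↥(labels M Λ)) : ‖cFam M A j‖ ≤ γ₀⁻¹ :=
  l2norm_cOp_le hγ hc hδ hA M j.1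

/-- **(5.15) in the `L²` operator norm**: `‖R_{j,j′}‖ ≤ αe^{−δ₂|j−j′|}`, `δ₂ = ¼δ₀`, `α = alpha515 d N c₀ δ₀ M` (from
the quadratic form `B4Sect5CubeBounds.ineq515_l2`). [cite: Balaban1983RegularityDecay, (5.15) p.595] -/
theorem l2norm_rPair_le {M : ℕ} (hM : 5 ≤ M) (hc : 0 ≤ c₀) (hδ : 0 < δ₀) {A : Matrix (B4.Idx Λ N) (B4.Idx Λ N) ℝ}
    (hA : ∀ p q : B4.Idx Λ N,
      |A p q| ≤ c₀ * Real.exp (-(δ₀ * dist (p.1 : Fin d → ℤ) (q.1 : Fin d → ℤ))))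
    (j j' : ↥(labels M Λ)) :
    ‖rPair A (pFam N M Λ) (hFam N M Λ) j j'‖ ≤
      alpha515 d N c₀ δ₀ M * Real.exp (-(δ₀ / 4 * dist (j.1 : Fin d → ℤ) (j'.1 : Fin d → ℤ))) :=
  l2norm_le_of_sq _ (by have := alpha515_nonneg d N hc hδ M; positivity) (ineq515_l2 hM hc hδ hA j j')

/-- *"γ₀^{−1}"* for the vertex factor: `‖h_jC_jh_j‖ ≤ γ₀^{−1}`. [cite: Balaban1983RegularityDecay, (5.18) p.595] -/
theorem l2norm_aFac_le (hγ : 0 < γ₀) (hc : 0 ≤ c₀) (hδ : 0 < δ₀) {A : Matrix (B4.Idx Λ N) (B4.Idx Λ N) ℝ}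
    (hA : B4.Hyp56 Λ A γ₀ c₀ δ₀) (M : ℕ) (j : ↥(labels M Λ)) :
    ‖aFac (hFam N M Λ) (cFam M A) j‖ ≤ γ₀⁻¹ := by
  have h1 := l2norm_hFam_le (N := N) M j
  have h2 := l2norm_cFam_le hγ hc hδ hA M j
  calc ‖aFac (hFam N M Λ) (cFam M A) j‖ = ‖hFam N M Λ j * cFam M A j * hFam N M Λ j‖ := rfl
    _ ≤ ‖hFam N M Λ j‖ * ‖cFam M A j‖ * ‖hFam N M Λ j‖ := norm_mul₃_le
    _ ≤ 1 * γ₀⁻¹ * 1 :=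
        mul_le_mul (mul_le_mul h1 h2 (norm_nonneg _) zero_le_one) h1 (norm_nonneg _) (by positivity)
    _ = γ₀⁻¹ := by ring

/-- *"αe^{−δ₂|ω_{2i−1}−ω_{2i}|}γ₀^{−1}"* for the pair factor: `‖R_{l,l′}C_{l′}h_{l′}‖ ≤ αe^{−δ₂|l−l′|}γ₀^{−1}`
(`M ≥ 5`). [cite: Balaban1983RegularityDecay, (5.15) p.595; (5.18) p.595] -/
theorem l2norm_bFac_le (hγ : 0 < γ₀) (hc : 0 ≤ c₀) (hδ : 0 < δ₀) {A : Matrix (B4.Idx Λ N) (B4.Idx Λ N) ℝ}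
    (hA : B4.Hyp56 Λ A γ₀ c₀ δ₀) {M : ℕ} (hM : 5 ≤ M) (q : ↥(labels M Λ) × ↥(labels M Λ)) :
    ‖bFac A (pFam N M Λ) (hFam N M Λ) (cFam M A) q‖ ≤
      alpha515 d N c₀ δ₀ M * Real.exp (-(δ₀ / 4 * dist (q.1.1 : Fin d → ℤ) (q.2.1 : Fin d → ℤ))) * γ₀⁻¹ := by
  have h1 := l2norm_rPair_le hM hc hδ hA.2.2 q.1 q.2
  have h2 := l2norm_cFam_le hγ hc hδ hA M q.2
  have h3 := l2norm_hFam_le (N := N) M q.2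
  have h0 : 0 ≤ alpha515 d N c₀ δ₀ M * Real.exp (-(δ₀ / 4 * dist (q.1.1 : Fin d → ℤ) (q.2.1 : Fin d → ℤ))) := by
    have := alpha515_nonneg d N hc hδ M; positivity
  calc ‖bFac A (pFam N M Λ) (hFam N M Λ) (cFam M A) q‖
      = ‖rPair A (pFam N M Λ) (hFam N M Λ) q.1 q.2 * cFam M A q.2 * hFam N M Λ q.2‖ := rfl
    _ ≤ ‖rPair A (pFam N M Λ) (hFam N M Λ) q.1 q.2‖ * ‖cFam M A q.2‖ * ‖hFam N M Λ q.2‖ := norm_mul₃_le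
    _ ≤ alpha515 d N c₀ δ₀ M * Real.exp (-(δ₀ / 4 * dist (q.1.1 : Fin d → ℤ) (q.2.1 : Fin d → ℤ))) *
          γ₀⁻¹ * 1 :=
        mul_le_mul (mul_le_mul h1 h2 (norm_nonneg _) h0) h3 (norm_nonneg _) (by positivity)
    _ = _ := by ring

end LatticeNorms

/-! ## §3 Cube geometry used in (5.18)–(5.21): adjacency, cubes through a point, walk length to distance -/

section Geometry

open Literature.MathematicalPhysics.QuantumFieldTheory.Balaban1983to89
open B4Commutators25to211 B4Sect5RandomWalk B4Sect5Proof B6GOmega B4Sect5CubeBounds B4RandomWalk213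
open scoped Matrix.Norms.L2Operator

variable {d N : ℕ} {Λ : Finset (Fin d → ℤ)} {γ₀ c₀ δ₀ : ℝ}

/-- adjacent labels (the restriction (5.17), *"max_μ|ω_{2i,μ} − ω_{2i+1,μ}| ≤ 1"*) are at sup-distance `≤ 1`.
[cite: Balaban1983RegularityDecay, (5.17) p.595] -/
theorem dist_le_one_of_adj {j j' : Fin d → ℤ} (h : Adj j j') : dist j j' ≤ 1 := by
  refine (dist_pi_le_iff zero_le_one).mpr fun μ => ?_
  rw [Int.dist_eq]
  have := h μ
  exact_mod_cast this

/-- *"|x − x′| ≤ M(|j − j′| + 2)"* for `x ∈ □_j`, `x′ ∈ □_{j′}` (cubes (5.11) of size `2M` at `Mj`, `Mj′`) — the step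
*"This inequality implies (5.7) with δ₁ = ½δ₂M^{−1}"* (p. 596; cf. the tree's `B4.walk_to_distance`).
[cite: Balaban1983RegularityDecay, (5.11) p.594; (5.21) p.596] -/
theorem dist_le_of_inBox {M : ℕ} {j l x x' : Fin d → ℤ} (hx : InBox M j x) (hx' : InBox M l x') :
    dist x x' ≤ M * (dist j l + 2) := by
  have hM0 : (0 : ℝ) ≤ M := Nat.cast_nonneg M
  refine (dist_pi_le_iff (by positivity)).mpr fun μ => ?_
  rw [Int.dist_eq]
  obtain ⟨h1, h2⟩ := hx μ
  obtain ⟨h3, h4⟩ := hx' μ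
  have h1r : -(M : ℝ) ≤ (x μ : ℝ) - M * j μ := by exact_mod_cast h1
  have h2r : (x μ : ℝ) - M * j μ ≤ M := by exact_mod_cast h2.le
  have h3r : -(M : ℝ) ≤ (x' μ : ℝ) - M * l μ := by exact_mod_cast h3
  have h4r : (x' μ : ℝ) - M * l μ ≤ M := by exact_mod_cast h4.le
  have hjl : |(j μ : ℝ) - l μ| ≤ dist j l := by
    have := dist_le_pi_dist j l μ; rwa [Int.dist_eq] at this
  obtain ⟨hjl1, hjl2⟩ := abs_le.mp hjl
  have hm1 : (M : ℝ) * ((j μ : ℝ) - l μ) ≤ M * dist j l := mul_le_mul_of_nonneg_left hjl2 hM0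
  have hm2 : (M : ℝ) * (-dist j l) ≤ M * ((j μ : ℝ) - l μ) := mul_le_mul_of_nonneg_left hjl1 hM0
  rw [abs_le]
  constructor <;> linarith

/-- **THE SUCCESSOR WEIGHT of (5.18)/(5.20)**: for every label `l`,
`Σ_{(l₁,l′): l ~ l₁} e^{ε(1 + |l₁−l′|)}‖R_{l₁,l′}C_{l′}h_{l′}‖ ≤ θ_W(M) := 3^d·K_d(ε)·e^{ε}·α(M)·γ₀^{−1}`, `ε = δ₀/8 = ½δ₂`
(the print's per-step constant `γ₀^{−1}αe^{dδ₂}c₂^{2d}`: `3^d` successors allowed by (5.17), the lattice sum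
`Σ_{l′}e^{−ε|l₁−l′|} ≤ K_d(ε)` of `B4Sect5Proof.latticeSum_le`). [cite: Balaban1983RegularityDecay, (5.18)–(5.21)
pp.595–596] -/
theorem sum_weight_bFac_le (hγ : 0 < γ₀) (hc : 0 ≤ c₀) (hδ : 0 < δ₀) {A : Matrix (B4.Idx Λ N) (B4.Idx Λ N) ℝ}
    (hA : B4.Hyp56 Λ A γ₀ c₀ δ₀) {M : ℕ} (hM : 5 ≤ M) (l : ↥(labels M Λ)) :
    ∑ q ∈ Finset.univ.filter (fun q : ↥(labels M Λ) × ↥(labels M Λ) => Adj l.1 q.1.1),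
      Real.exp (δ₀ / 8 * (1 + dist (q.1.1 : Fin d → ℤ) (q.2.1 : Fin d → ℤ))) *
        ‖bFac A (pFam N M Λ) (hFam N M Λ) (cFam M A) q‖ ≤
      3 ^ d * (latticeConst d (δ₀ / 8) * (Real.exp (δ₀ / 8) * alpha515 d N c₀ δ₀ M * γ₀⁻¹)) := by
  have hα := alpha515_nonneg d N hc hδ M
  have hK := latticeConst_nonneg d (by positivity : (0:ℝ) ≤ δ₀ / 8)
  set B := Real.exp (δ₀ / 8) * alpha515 d N c₀ δ₀ M * γ₀⁻¹ with hB
  have hB0 : 0 ≤ B := by positivity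
  -- one step: weight × norm ≤ B e^{−ε dist}
  have hstep : ∀ q : ↥(labels M Λ) × ↥(labels M Λ),
      Real.exp (δ₀ / 8 * (1 + dist (q.1.1 : Fin d → ℤ) (q.2.1 : Fin d → ℤ))) *
        ‖bFac A (pFam N M Λ) (hFam N M Λ) (cFam M A) q‖ ≤
        B * Real.exp (-(δ₀ / 8 * dist (q.1.1 : Fin d → ℤ) (q.2.1 : Fin d → ℤ))) := by
    intro q
    have h1 := l2norm_bFac_le hγ hc hδ hA hM q
    set D := dist (q.1.1 : Fin d → ℤ) (q.2.1 : Fin d → ℤ) with hD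
    calc Real.exp (δ₀ / 8 * (1 + D)) * ‖bFac A (pFam N M Λ) (hFam N M Λ) (cFam M A) q‖
        ≤ Real.exp (δ₀ / 8 * (1 + D)) * (alpha515 d N c₀ δ₀ M * Real.exp (-(δ₀ / 4 * D)) * γ₀⁻¹) :=
          mul_le_mul_of_nonneg_left h1 (Real.exp_pos _).le
      _ = B * Real.exp (-(δ₀ / 8 * D)) := by
          rw [hB]
          have : Real.exp (δ₀ / 8 * (1 + D)) * Real.exp (-(δ₀ / 4 * D)) =
              Real.exp (δ₀ / 8) * Real.exp (-(δ₀ / 8 * D)) := by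
            rw [← Real.exp_add, ← Real.exp_add]; congr 1; ring
          calc Real.exp (δ₀ / 8 * (1 + D)) * (alpha515 d N c₀ δ₀ M * Real.exp (-(δ₀ / 4 * D)) * γ₀⁻¹)
              = (Real.exp (δ₀ / 8 * (1 + D)) * Real.exp (-(δ₀ / 4 * D))) * alpha515 d N c₀ δ₀ M * γ₀⁻¹ := by
                ring
            _ = _ := by rw [this]; ring
  have hinner : ∀ j₁ : ↥(labels M Λ),
      ∑ j₂ : ↥(labels M Λ), Real.exp (-(δ₀ / 8 * dist (j₁.1 : Fin d → ℤ) (j₂.1 : Fin d → ℤ))) ≤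
        latticeConst d (δ₀ / 8) := by
    intro j₁
    rw [Finset.sum_coe_sort (labels M Λ)
      (fun j₂ => Real.exp (-(δ₀ / 8 * dist (j₁.1 : Fin d → ℤ) j₂)))]
    exact latticeSum_le d (by positivity) (labels M Λ) j₁.1
  calc ∑ q ∈ Finset.univ.filter (fun q : ↥(labels M Λ) × ↥(labels M Λ) => Adj l.1 q.1.1),
        Real.exp (δ₀ / 8 * (1 + dist (q.1.1 : Fin d → ℤ) (q.2.1 : Fin d → ℤ))) *
          ‖bFac A (pFam N M Λ) (hFam N M Λ) (cFam M A) q‖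
      ≤ ∑ q ∈ Finset.univ.filter (fun q : ↥(labels M Λ) × ↥(labels M Λ) => Adj l.1 q.1.1),
          B * Real.exp (-(δ₀ / 8 * dist (q.1.1 : Fin d → ℤ) (q.2.1 : Fin d → ℤ))) :=
        Finset.sum_le_sum fun q _ => hstep q
    _ = ∑ j₁ : ↥(labels M Λ), ∑ j₂ : ↥(labels M Λ), (if Adj l.1 j₁.1 then
          B * Real.exp (-(δ₀ / 8 * dist (j₁.1 : Fin d → ℤ) (j₂.1 : Fin d → ℤ))) else 0) := by
        rw [Finset.sum_filter, Fintype.sum_prod_type]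
    _ ≤ ∑ j₁ : ↥(labels M Λ), (if Adj l.1 j₁.1 then B * latticeConst d (δ₀ / 8) else 0) := by
        refine Finset.sum_le_sum fun j₁ _ => ?_
        split_ifs with hadj
        · rw [← Finset.mul_sum]; exact mul_le_mul_of_nonneg_left (hinner j₁) hB0
        · simp
    _ = ((labels M Λ).filter fun j₁ => Adj l.1 j₁).card * (B * latticeConst d (δ₀ / 8)) := by
        rw [Finset.sum_coe_sort (labels M Λ) (fun j₁ => if Adj l.1 j₁ then B * latticeConst d (δ₀ / 8) else 0),
          ← Finset.sum_filter, Finset.sum_const, nsmul_eq_mul]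
    _ ≤ 3 ^ d * (B * latticeConst d (δ₀ / 8)) := by
        apply mul_le_mul_of_nonneg_right _ (by positivity)
        exact_mod_cast card_filter_adj_le (labels M Λ) l.1
    _ = 3 ^ d * (latticeConst d (δ₀ / 8) * B) := by ring

/-- at most `2^d` labels `j` with `x ∈ □_j` (p. 578, *"at most 2^d cubes"*), as a bound on an indicator sum over
the labels. [cite: Balaban1983RegularityDecay, (5.11) p.594; p.578] -/
theorem sum_indicator_inBox_le {M : ℕ} (hM : 0 < M) (x : Fin d → ℤ) :
    ∑ j : ↥(labels M Λ), (if InBox M j.1 x then (1 : ℝ) else 0) ≤ 2 ^ d := by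
  rw [Finset.sum_coe_sort (labels M Λ) (fun j => if InBox M j x then (1 : ℝ) else 0), ← Finset.sum_filter,
    Finset.sum_const, nsmul_eq_mul, mul_one]
  exact_mod_cast card_filter_inBox_le hM (labels M Λ) x

end Geometry

/-! ## §4 The support of a walk term: *"ω: x ∈ □_{ω₀}, x′ ∈ □_{ω_{2n}}"* -/

section Support

open Literature.MathematicalPhysics.QuantumFieldTheory.Balaban1983to89
open B4Commutators25to211 B4Sect5RandomWalk B4Sect5Proof B6GOmega B4Sect5CubeBounds B4RandomWalk213
open scoped Matrix.Norms.L2Operator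

variable {d N : ℕ} {Λ : Finset (Fin d → ℤ)}

/-- a multiplication operator by a function vanishing on `supp h_j` kills `h_j` from the left. [cite:
Balaban1983RegularityDecay, (5.12) p.594] -/
theorem mulH_mul_hFam_eq_zero {M : ℕ} {j : ↥(labels M Λ)} {g : ↥Λ → ℝ}
    (hg : ∀ x : ↥Λ, g x * hfun M j.1 (x : Fin d → ℤ) = 0) : mulH (ι := Fin N) g * hFam N M Λ j = 0 := by
  rw [hFam, mulH_mul_mulH, show (fun x : ↥Λ => g x * hfun M j.1 (x : Fin d → ℤ)) = (0 : ↥Λ → ℝ) from funext hg]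
  exact mulH_zero

/-- … and from the right. [cite: Balaban1983RegularityDecay, (5.12) p.594] -/
theorem hFam_mul_mulH_eq_zero {M : ℕ} {j : ↥(labels M Λ)} {g : ↥Λ → ℝ}
    (hg : ∀ x : ↥Λ, hfun M j.1 (x : Fin d → ℤ) * g x = 0) : hFam N M Λ j * mulH (ι := Fin N) g = 0 := by
  rw [hFam, mulH_mul_mulH, show (fun x : ↥Λ => hfun M j.1 (x : Fin d → ℤ) * g x) = (0 : ↥Λ → ℝ) from funext hg]
  exact mulH_zero

/-- **LEFT SUPPORT** of the walk term `h_{ω₀}C_{ω₀}h_{ω₀}R_{ω₁,ω₂}⋯`: its `(x, ·)` entries vanish unless `h_{ω₀}(x) ≠ 0`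
(so `x ∈ □_{ω₀}`) — the condition *"ω: x ∈ □_{ω₀}"* under the sum (5.18). [cite: Balaban1983RegularityDecay, (5.18)
p.595] -/
theorem walkTerm_apply_eq_zero_left {M : ℕ} (A : Matrix (B4.Idx Λ N) (B4.Idx Λ N) ℝ)
    (ω : Σ n : ℕ, ↥(labels M Λ) × (Fin n → ↥(labels M Λ) × ↥(labels M Λ))) (p q : B4.Idx Λ N)
    (hp : hfun M ω.2.1.1 (p.1 : Fin d → ℤ) = 0) :
    walkTerm517 (aFac (hFam N M Λ) (cFam M A)) (bFac A (pFam N M Λ) (hFam N M Λ) (cFam M A)) ω p q = 0 := by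
  classical
  set g : ↥Λ → ℝ := fun x => if x = p.1 then 1 else 0 with hg
  have hkill : mulH (ι := Fin N) g * hFam N M Λ ω.2.1 = 0 := by
    refine mulH_mul_hFam_eq_zero fun x => ?_
    by_cases hx : x = p.1
    · rw [hx, hp, mul_zero]
    · simp [hg, hx]
  have hprod : mulH (ι := Fin N) g *
      walkTerm517 (aFac (hFam N M Λ) (cFam M A)) (bFac A (pFam N M Λ) (hFam N M Λ) (cFam M A)) ω = 0 := by
    simp only [walkTerm517, aFac]
    rw [← Matrix.mul_assoc, ← Matrix.mul_assoc, ← Matrix.mul_assoc, hkill]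
    simp
  have h := congrFun (congrFun hprod p) q
  rw [mulH_mul_apply, Matrix.zero_apply] at h
  simpa [hg] using h

/-- **RIGHT SUPPORT**: the `(·, x′)` entries vanish unless `h_{ω_{2n}}(x′) ≠ 0` (so `x′ ∈ □_{ω_{2n}}`), `ω_{2n}` =
the end label `lastPt` — the condition *"x′ ∈ □_{ω_{2n}}"* of (5.18). [cite: Balaban1983RegularityDecay, (5.18)
p.595] -/
theorem walkTerm_apply_eq_zero_right {M : ℕ} (A : Matrix (B4.Idx Λ N) (B4.Idx Λ N) ℝ)
    (ω : Σ n : ℕ, ↥(labels M Λ) × (Fin n → ↥(labels M Λ) × ↥(labels M Λ))) (p q : B4.Idx Λ N)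
    (hq : hfun M (lastPt ω.2.1 ω.1 (fun i => (ω.2.2 i).2)).1 (q.1 : Fin d → ℤ) = 0) :
    walkTerm517 (aFac (hFam N M Λ) (cFam M A)) (bFac A (pFam N M Λ) (hFam N M Λ) (cFam M A)) ω p q = 0 := by
  classical
  set g : ↥Λ → ℝ := fun x => if x = q.1 then 1 else 0 with hg
  have hkill : ∀ l : ↥(labels M Λ), hfun M l.1 (q.1 : Fin d → ℤ) = 0 →
      hFam N M Λ l * mulH (ι := Fin N) g = 0 := by
    intro l hl
    refine hFam_mul_mulH_eq_zero fun x => ?_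
    by_cases hx : x = q.1
    · rw [hx, hl, zero_mul]
    · simp [hg, hx]
  obtain ⟨n, j, ys⟩ := ω
  have hprod : walkTerm517 (aFac (hFam N M Λ) (cFam M A)) (bFac A (pFam N M Λ) (hFam N M Λ) (cFam M A))
      ⟨n, j, ys⟩ * mulH (ι := Fin N) g = 0 := by
    cases n with
    | zero =>
        simp only [walkTerm517, aFac, bprod_zero, Matrix.mul_one]
        rw [Matrix.mul_assoc, hkill j (by simpa using hq)]
        simp
    | succ k =>
        simp only [walkTerm517]
        refine mul_bprod_mul_eq_zero_of_last _ k (aFac (hFam N M Λ) (cFam M A) j) ys ?_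
        simp only [bFac]
        rw [Matrix.mul_assoc, hkill (ys (Fin.last k)).2 (by simpa [lastPt_succ] using hq)]
        simp
  have h := congrFun (congrFun hprod p) q
  rw [mul_mulH_apply, Matrix.zero_apply] at h
  simpa [hg] using h

end Support

/-! ## §5 (5.18): the entrywise bound of one walk term, and of one level `n` -/

section Level

open Literature.MathematicalPhysics.QuantumFieldTheory.Balaban1983to89
open B4Commutators25to211 B4Sect5RandomWalk B4Sect5Proof B6GOmega B4Sect5CubeBounds B4RandomWalk213
open scoped Matrix.Norms.L2Operator

variable {d N : ℕ} {Λ : Finset (Fin d → ℤ)} {γ₀ c₀ δ₀ : ℝ}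

/-- **(5.18), ONE WALK TERM, entrywise**: `|⟨δ_x, h_{ω₀}C_{ω₀}h_{ω₀}R_{ω₁,ω₂}⋯C_{ω_{2n}}h_{ω_{2n}}δ_{x′}⟩|` vanishes unless
`x ∈ □_{ω₀}` and `x′ ∈ □_{ω_{2n}}`, and then `|x − x′| ≤ M(|ω₀ − ω_{2n}| + 2)`; hence for every walk
`|term_ω(x,x′)| ≤ 1[x ∈ □_{ω₀}]·e^{δ₀/4}e^{−(δ₀/(8M))|x−x′|}·(e^{(δ₀/8)|ω₀−ω_{2n}|}‖term_ω‖)` (the weight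
`e^{(δ₀/8)|ω₀−ω_{2n}|} = e^{½δ₂|j−j′|}` is the one (5.21) converts into `e^{−½δ₂M^{−1}|x−x′|}`). [cite:
Balaban1983RegularityDecay, (5.18) p.595; (5.21) p.596] -/
theorem abs_walkTerm_apply_le (hδ : 0 < δ₀) {M : ℕ} (hM : 0 < M) (A : Matrix (B4.Idx Λ N) (B4.Idx Λ N) ℝ)
    (ω : Σ n : ℕ, ↥(labels M Λ) × (Fin n → ↥(labels M Λ) × ↥(labels M Λ))) (p q : B4.Idx Λ N) :
    |walkTerm517 (aFac (hFam N M Λ) (cFam M A)) (bFac A (pFam N M Λ) (hFam N M Λ) (cFam M A)) ω p q| ≤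
      (if InBox M ω.2.1.1 (p.1 : Fin d → ℤ) then 1 else 0) *
        (Real.exp (δ₀ / 4) * Real.exp (-(δ₀ / (8 * M) * dist (p.1 : Fin d → ℤ) (q.1 : Fin d → ℤ)))) *
        (Real.exp (δ₀ / 8 * dist (ω.2.1.1 : Fin d → ℤ) ((lastPt ω.2.1 ω.1 (fun i => (ω.2.2 i).2)).1 : Fin d → ℤ)) *
          ‖walkTerm517 (aFac (hFam N M Λ) (cFam M A)) (bFac A (pFam N M Λ) (hFam N M Λ) (cFam M A)) ω‖) := by
  set T := walkTerm517 (aFac (hFam N M Λ) (cFam M A)) (bFac A (pFam N M Λ) (hFam N M Λ) (cFam M A)) ω with hT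
  by_cases hz : T p q = 0
  · rw [hz, abs_zero]; positivity
  · have hp : hfun M ω.2.1.1 (p.1 : Fin d → ℤ) ≠ 0 := fun h => hz (walkTerm_apply_eq_zero_left A ω p q h)
    have hq : hfun M (lastPt ω.2.1 ω.1 (fun i => (ω.2.2 i).2)).1 (q.1 : Fin d → ℤ) ≠ 0 :=
      fun h => hz (walkTerm_apply_eq_zero_right A ω p q h)
    have hpB := inBox_of_hfun_ne_zero hM hp
    have hqB := inBox_of_hfun_ne_zero hM hq
    rw [if_pos hpB, one_mul]
    set D := dist (p.1 : Fin d → ℤ) (q.1 : Fin d → ℤ) with hD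
    set E := dist (ω.2.1.1 : Fin d → ℤ) ((lastPt ω.2.1 ω.1 (fun i => (ω.2.2 i).2)).1 : Fin d → ℤ) with hE
    have hMr : (0 : ℝ) < M := by exact_mod_cast hM
    have hDE : D ≤ M * (E + 2) := dist_le_of_inBox hpB hqB
    have hexp : 1 ≤ Real.exp (δ₀ / 4) * Real.exp (-(δ₀ / (8 * M) * D)) * Real.exp (δ₀ / 8 * E) := by
      rw [← Real.exp_add, ← Real.exp_add]
      apply Real.one_le_exp
      have h1 : δ₀ / (8 * M) * D ≤ δ₀ / (8 * M) * (M * (E + 2)) :=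
        mul_le_mul_of_nonneg_left hDE (by positivity)
      have h2 : δ₀ / (8 * M) * (M * (E + 2)) = δ₀ / 8 * (E + 2) := by field_simp
      linarith
    have h1 : |T p q| ≤ ‖T‖ := abs_entry_le_l2norm T p q
    calc |T p q| ≤ 1 * ‖T‖ := by rw [one_mul]; exact h1
      _ ≤ (Real.exp (δ₀ / 4) * Real.exp (-(δ₀ / (8 * M) * D)) * Real.exp (δ₀ / 8 * E)) * ‖T‖ :=
          mul_le_mul_of_nonneg_right hexp (norm_nonneg _)
      _ = _ := by ring

/-- **(5.18), the walk term's norm**: `‖h_{ω₀}C_{ω₀}h_{ω₀}·Π_i R_{ω_{2i−1},ω_{2i}}C_{ω_{2i}}h_{ω_{2i}}‖ ≤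
γ₀^{−(n+1)}αⁿ Π_i e^{−δ₂|ω_{2i−1}−ω_{2i}|}` (`L²` operator norms; `‖h‖ ≤ 1`, `‖C‖ ≤ γ₀^{−1}`, (5.15)). [cite:
Balaban1983RegularityDecay, (5.18) p.595] -/
theorem norm_walkTerm_le (hγ : 0 < γ₀) (hc : 0 ≤ c₀) (hδ : 0 < δ₀) {A : Matrix (B4.Idx Λ N) (B4.Idx Λ N) ℝ}
    (hA : B4.Hyp56 Λ A γ₀ c₀ δ₀) {M : ℕ} (hM : 5 ≤ M) (n : ℕ) (j : ↥(labels M Λ))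
    (ys : Fin n → ↥(labels M Λ) × ↥(labels M Λ)) :
    ‖walkTerm517 (aFac (hFam N M Λ) (cFam M A)) (bFac A (pFam N M Λ) (hFam N M Λ) (cFam M A)) ⟨n, j, ys⟩‖ ≤
      γ₀⁻¹ * ∏ i, (alpha515 d N c₀ δ₀ M *
        Real.exp (-(δ₀ / 4 * dist ((ys i).1.1 : Fin d → ℤ) ((ys i).2.1 : Fin d → ℤ))) * γ₀⁻¹) := by
  have h := norm_mul_bprod_le_prod (b := bFac A (pFam N M Λ) (hFam N M Λ) (cFam M A))
    (β := fun q : ↥(labels M Λ) × ↥(labels M Λ) => alpha515 d N c₀ δ₀ M *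
      Real.exp (-(δ₀ / 4 * dist (q.1.1 : Fin d → ℤ) (q.2.1 : Fin d → ℤ))) * γ₀⁻¹)
    (fun q => l2norm_bFac_le hγ hc hδ hA hM q) n (aFac (hFam N M Λ) (cFam M A) j) ys
  refine h.trans (mul_le_mul_of_nonneg_right (l2norm_aFac_le hγ hc hδ hA M j) ?_)
  exact Finset.prod_nonneg fun i _ => by have := alpha515_nonneg d N hc hδ M; positivity

/-- **(5.18)–(5.20), ONE LEVEL**: summing the walk terms of order `n` through `x ∈ □_{ω₀}`,
`Σ_{(ω₀; pairs)} |term(x,x′)| ≤ 2^d·γ₀^{−1}·e^{δ₀/4}·e^{−(δ₀/(8M))|x−x′|}·θ_W(M)ⁿ`,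
`θ_W(M) = 3^dK_d(δ₀/8)e^{δ₀/8}α(M)γ₀^{−1}` — the print's `γ₀^{−(n+1)}αⁿ(e^{dδ₂})ⁿ·(c₂ⁿ-convolution)` with the
`e^{−½δ₂|j−j′|}` already converted to `e^{−½δ₂M^{−1}|x−x′|}`. [cite: Balaban1983RegularityDecay, (5.18)–(5.21)
pp.595–596] -/
theorem level_abs_sum_le (hγ : 0 < γ₀) (hc : 0 ≤ c₀) (hδ : 0 < δ₀) {A : Matrix (B4.Idx Λ N) (B4.Idx Λ N) ℝ}
    (hA : B4.Hyp56 Λ A γ₀ c₀ δ₀) {M : ℕ} (hM : 5 ≤ M) (n : ℕ) (p q : B4.Idx Λ N) :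
    ∑ cc : ↥(labels M Λ) × (Fin n → ↥(labels M Λ) × ↥(labels M Λ)),
      |walkTerm517 (aFac (hFam N M Λ) (cFam M A)) (bFac A (pFam N M Λ) (hFam N M Λ) (cFam M A)) ⟨n, cc⟩ p q| ≤
      2 ^ d * γ₀⁻¹ * Real.exp (δ₀ / 4) * Real.exp (-(δ₀ / (8 * M) * dist (p.1 : Fin d → ℤ) (q.1 : Fin d → ℤ))) *
        (3 ^ d * (latticeConst d (δ₀ / 8) * (Real.exp (δ₀ / 8) * alpha515 d N c₀ δ₀ M * γ₀⁻¹))) ^ n := by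
  have hM0 : 0 < M := by omega
  set a := aFac (hFam N M Λ) (cFam M A) with ha
  set b := bFac A (pFam N M Λ) (hFam N M Λ) (cFam M A) with hb
  set θ := 3 ^ d * (latticeConst d (δ₀ / 8) * (Real.exp (δ₀ / 8) * alpha515 d N c₀ δ₀ M * γ₀⁻¹)) with hθ
  set E := Real.exp (δ₀ / 4) * Real.exp (-(δ₀ / (8 * M) * dist (p.1 : Fin d → ℤ) (q.1 : Fin d → ℤ))) with hE
  have hθ0 : 0 ≤ θ := by
    have := alpha515_nonneg d N hc hδ M
    have := latticeConst_nonneg d (by positivity : (0:ℝ) ≤ δ₀ / 8)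
    positivity
  have hE0 : 0 ≤ E := by positivity
  -- the weighted Schur line for each starting label
  have hlevel : ∀ j : ↥(labels M Λ),
      ∑ ys : Fin n → ↥(labels M Λ) × ↥(labels M Λ),
        Real.exp (δ₀ / 8 * dist (j.1 : Fin d → ℤ) ((lastPt j n (fun i => (ys i).2)).1 : Fin d → ℤ)) *
          ‖a j * bprod b n ys‖ ≤ ‖a j‖ * θ ^ n := by
    intro j
    exact weighted_level_exp_le (fun l l' : ↥(labels M Λ) => Adj l.1 l'.1)
      (fun l l' : ↥(labels M Λ) => dist (l.1 : Fin d → ℤ) (l'.1 : Fin d → ℤ)) (fun l => dist_self _)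
      (fun l l' l'' => dist_triangle _ _ _) (fun l l' h => dist_le_one_of_adj h) (by positivity)
      (fun q q' h => bFac_mul_bFac_eq_zero hM0 A q q' h) (sum_weight_bFac_le hγ hc hδ hA hM) n j (a j)
      (fun q h => aFac_mul_bFac_eq_zero hM0 A j q h)
  calc ∑ cc : ↥(labels M Λ) × (Fin n → ↥(labels M Λ) × ↥(labels M Λ)), |walkTerm517 a b ⟨n, cc⟩ p q|
      = ∑ j : ↥(labels M Λ), ∑ ys : Fin n → ↥(labels M Λ) × ↥(labels M Λ), |walkTerm517 a b ⟨n, j, ys⟩ p q| :=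
        Fintype.sum_prod_type _
    _ ≤ ∑ j : ↥(labels M Λ), ∑ ys : Fin n → ↥(labels M Λ) × ↥(labels M Λ),
          (if InBox M j.1 (p.1 : Fin d → ℤ) then (1 : ℝ) else 0) * E *
            (Real.exp (δ₀ / 8 * dist (j.1 : Fin d → ℤ) ((lastPt j n (fun i => (ys i).2)).1 : Fin d → ℤ)) *
              ‖a j * bprod b n ys‖) :=
        Finset.sum_le_sum fun j _ => Finset.sum_le_sum fun ys _ => abs_walkTerm_apply_le hδ hM0 A ⟨n, j, ys⟩ p q
    _ = ∑ j : ↥(labels M Λ), (if InBox M j.1 (p.1 : Fin d → ℤ) then (1 : ℝ) else 0) * E *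
          ∑ ys : Fin n → ↥(labels M Λ) × ↥(labels M Λ),
            Real.exp (δ₀ / 8 * dist (j.1 : Fin d → ℤ) ((lastPt j n (fun i => (ys i).2)).1 : Fin d → ℤ)) *
              ‖a j * bprod b n ys‖ := by
        simp only [Finset.mul_sum]
    _ ≤ ∑ j : ↥(labels M Λ), (if InBox M j.1 (p.1 : Fin d → ℤ) then (1 : ℝ) else 0) * E * (γ₀⁻¹ * θ ^ n) := by
        refine Finset.sum_le_sum fun j _ => mul_le_mul_of_nonneg_left ?_ (by positivity)
        exact (hlevel j).trans (mul_le_mul_of_nonneg_right (l2norm_aFac_le hγ hc hδ hA M j) (pow_nonneg hθ0 n))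
    _ = (∑ j : ↥(labels M Λ), (if InBox M j.1 (p.1 : Fin d → ℤ) then (1 : ℝ) else 0)) * (E * (γ₀⁻¹ * θ ^ n)) := by
        rw [Finset.sum_mul]; refine Finset.sum_congr rfl fun j _ => ?_; ring
    _ ≤ 2 ^ d * (E * (γ₀⁻¹ * θ ^ n)) :=
        mul_le_mul_of_nonneg_right (sum_indicator_inBox_le hM0 _) (by positivity)
    _ = 2 ^ d * γ₀⁻¹ * Real.exp (δ₀ / 4) *
          Real.exp (-(δ₀ / (8 * M) * dist (p.1 : Fin d → ℤ) (q.1 : Fin d → ℤ))) * θ ^ n := by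
        rw [hE]; ring

end Level

/-! ## §6 (5.21) ⇒ (5.7): the geometric series over `n`, "we fix M", and the printed form for every `Λ ⊂ Ω` -/

section Main

open Literature.MathematicalPhysics.QuantumFieldTheory.Balaban1983to89
open B4Commutators25to211 B4Sect5RandomWalk B4Sect5Proof B6GOmega B4Sect5CubeBounds B4RandomWalk213
open scoped Matrix.Norms.L2Operator

variable {d N : ℕ} {Λ : Finset (Fin d → ℤ)} {γ₀ c₀ δ₀ : ℝ}

/-- the walk expansion (5.17) of `A_Λ^{−1}` read ENTRYWISE (a `HasSum` of matrices is a `HasSum` of each entry).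
[cite: Balaban1983RegularityDecay, (5.17) p.595] -/
theorem hasSum_walkTerm_apply (hγ : 0 < γ₀) (hc : 0 ≤ c₀) (hδ : 0 < δ₀) {A : Matrix (B4.Idx Λ N) (B4.Idx Λ N) ℝ}
    (hA : B4.Hyp56 Λ A γ₀ c₀ δ₀) {M : ℕ} (hM : 5 ≤ M) (hMR : kR d N γ₀ c₀ δ₀ < M)
    (hMθ : thetaConst d N γ₀ c₀ δ₀ < M) (p q : B4.Idx Λ N) :
    HasSum (fun ω => walkTerm517 (aFac (hFam N M Λ) (cFam M A))
      (bFac A (pFam N M Λ) (hFam N M Λ) (cFam M A)) ω p q) (A⁻¹ p q) := by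
  have h := hasSum517_lattice' hγ hc hδ hA hM hMR hMθ
  exact Pi.hasSum.mp (Pi.hasSum.mp h p) q

/-- **(5.18), first inequality**: *"|C_Λ(x,x′)| ≤ Σ_{ω: x∈□_{ω₀}, x′∈□_{ω_{2n}}} |⟨δ_x, … δ_{x′}⟩|"* — the entry of
`A_Λ^{−1}` is bounded by the (absolutely convergent) sum of the absolute entries of the walk terms.
[cite: Balaban1983RegularityDecay, (5.18) p.595] -/
theorem abs_inv_apply_le_tsum_abs (hγ : 0 < γ₀) (hc : 0 ≤ c₀) (hδ : 0 < δ₀) {A : Matrix (B4.Idx Λ N) (B4.Idx Λ N) ℝ}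
    (hA : B4.Hyp56 Λ A γ₀ c₀ δ₀) {M : ℕ} (hM : 5 ≤ M) (hMR : kR d N γ₀ c₀ δ₀ < M)
    (hMθ : thetaConst d N γ₀ c₀ δ₀ < M) (p q : B4.Idx Λ N) :
    |A⁻¹ p q| ≤ ∑' ω, |walkTerm517 (aFac (hFam N M Λ) (cFam M A))
      (bFac A (pFam N M Λ) (hFam N M Λ) (cFam M A)) ω p q| := by
  have hf := hasSum_walkTerm_apply hγ hc hδ hA hM hMR hMθ p q
  have habs : Summable fun ω => ‖walkTerm517 (aFac (hFam N M Λ) (cFam M A))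
      (bFac A (pFam N M Λ) (hFam N M Λ) (cFam M A)) ω p q‖ := by
    simpa only [Real.norm_eq_abs] using hf.summable.abs
  have h := norm_tsum_le_tsum_norm habs
  rw [hf.tsum_eq] at h
  simpa only [Real.norm_eq_abs] using h

/-- **(5.21) ⇒ (5.7)** p. 596 [PDF 26], verbatim: *"Finally we fix M such that γ₀^{−1}αe^{dδ₂}c₂^{2d} < 1, and we get
|C_Λ(x,x′)| ≤ Σ_{j,j′: x∈□_j, x′∈□_{j′}} γ₀^{−1}e^{dδ₂}(1 − γ₀^{−1}e^{dδ₂}c₂^{2d}α)^{−1}e^{−½δ₂|j−j′|} ≤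
c₁e^{−½δ₂M^{−1}|x−x′|}. (5.21) This inequality implies (5.7) with δ₁ = ½δ₂M^{−1}."* — typed on `L²(Λ; ℝ^N)`,
`Λ ⊂ ℤ^d` finite, `A` (= the print's `A_Λ`) with (5.6): for every cube size `M ≥ 5` with `M > K_R`, `M > Θ₁` (the
expansion (5.17) converges, `B4Sect5CubeBounds.hasSum517_lattice'`) and `θ_W(M) = 3^dK_d(δ₀/8)e^{δ₀/8}α(M)γ₀^{−1} <
1`:  `|A_Λ^{−1}(x,x′)| ≤ 2^dγ₀^{−1}e^{δ₀/4}(1 − θ_W(M))^{−1}·e^{−(δ₀/(8M))|x−x′|}` (`δ₁ = ½δ₂M^{−1} = δ₀/(8M)`).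
[cite: Balaban1983RegularityDecay, (5.21) p.596; (5.7) p.594] -/
theorem abs_inv_apply_le_of_walk (hγ : 0 < γ₀) (hc : 0 ≤ c₀) (hδ : 0 < δ₀) {A : Matrix (B4.Idx Λ N) (B4.Idx Λ N) ℝ}
    (hA : B4.Hyp56 Λ A γ₀ c₀ δ₀) {M : ℕ} (hM : 5 ≤ M) (hMR : kR d N γ₀ c₀ δ₀ < M)
    (hMθ : thetaConst d N γ₀ c₀ δ₀ < M)
    (hθW : 3 ^ d * (latticeConst d (δ₀ / 8) * (Real.exp (δ₀ / 8) * alpha515 d N c₀ δ₀ M * γ₀⁻¹)) < 1)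
    (p q : B4.Idx Λ N) :
    |A⁻¹ p q| ≤ 2 ^ d * γ₀⁻¹ * Real.exp (δ₀ / 4) *
      (1 - 3 ^ d * (latticeConst d (δ₀ / 8) * (Real.exp (δ₀ / 8) * alpha515 d N c₀ δ₀ M * γ₀⁻¹)))⁻¹ *
        Real.exp (-(δ₀ / (8 * M) * dist (p.1 : Fin d → ℤ) (q.1 : Fin d → ℤ))) := by
  set θ := 3 ^ d * (latticeConst d (δ₀ / 8) * (Real.exp (δ₀ / 8) * alpha515 d N c₀ δ₀ M * γ₀⁻¹)) with hθ
  set C := 2 ^ d * γ₀⁻¹ * Real.exp (δ₀ / 4) *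
    Real.exp (-(δ₀ / (8 * M) * dist (p.1 : Fin d → ℤ) (q.1 : Fin d → ℤ))) with hC
  have hθ0 : 0 ≤ θ := by
    have := alpha515_nonneg d N hc hδ M
    have := latticeConst_nonneg d (by positivity : (0:ℝ) ≤ δ₀ / 8)
    positivity
  set f := fun ω => walkTerm517 (aFac (hFam N M Λ) (cFam M A))
      (bFac A (pFam N M Λ) (hFam N M Λ) (cFam M A)) ω p q with hf
  have hsum := hasSum_walkTerm_apply hγ hc hδ hA hM hMR hMθ p q
  have habs : Summable fun ω => |f ω| := hsum.summable.abs
  have h1 : |A⁻¹ p q| ≤ ∑' ω, |f ω| := abs_inv_apply_le_tsum_abs hγ hc hδ hA hM hMR hMθ p q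
  have h2 : ∑' ω, |f ω| = ∑' n, ∑' cc, |f ⟨n, cc⟩| :=
    Summable.tsum_sigma' (fun n => (hasSum_fintype _).summable) habs
  have h3 : ∀ n, ∑' cc, |f ⟨n, cc⟩| ≤ C * θ ^ n := fun n => by
    rw [tsum_fintype]; exact level_abs_sum_le hγ hc hδ hA hM n p q
  have h4 : Summable fun n => ∑' cc, |f ⟨n, cc⟩| := habs.sigma
  have h5 : ∑' n, ∑' cc, |f ⟨n, cc⟩| ≤ ∑' n : ℕ, C * θ ^ n :=
    Summable.tsum_le_tsum h3 h4 ((summable_geometric_of_lt_one hθ0 hθW).mul_left C)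
  have h6 : ∑' n : ℕ, C * θ ^ n = C * (1 - θ)⁻¹ := by
    rw [tsum_mul_left, tsum_geometric_of_lt_one hθ0 hθW]
  calc |A⁻¹ p q| ≤ ∑' n, ∑' cc, |f ⟨n, cc⟩| := h1.trans_eq h2
    _ ≤ C * (1 - θ)⁻¹ := h5.trans_eq h6
    _ = _ := by rw [hC]; ring

/-- *"α depending on M and arbitrarily small if M is sufficiently large"* ⇒ `θ_W(M) ≤ Θ_W/M` with
`Θ_W = 3^dK_d(δ₀/8)e^{δ₀/8}γ₀^{−1}·((3πd/2)M₀ + c₀NK_d(δ₀/4)(10/δ₀))` (`B4Sect5CubeBounds.alpha515_le`).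
[cite: Balaban1983RegularityDecay, (5.15) p.595; p.596 "we fix M"] -/
theorem thetaW_le (hγ : 0 < γ₀) (hc : 0 ≤ c₀) (hδ : 0 < δ₀) {M : ℕ} (hM : 0 < M) :
    3 ^ d * (latticeConst d (δ₀ / 8) * (Real.exp (δ₀ / 8) * alpha515 d N c₀ δ₀ M * γ₀⁻¹)) ≤
      3 ^ d * (latticeConst d (δ₀ / 8) * (Real.exp (δ₀ / 8) * γ₀⁻¹ *
        (3 * Real.pi * d / 2 * weightConst d N c₀ δ₀ + c₀ * (N * latticeConst d (δ₀ / 4)) * (10 / δ₀)))) / M := by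
  have hα := alpha515_le (d := d) (N := N) hM hc hδ
  have hK := latticeConst_nonneg d (by positivity : (0:ℝ) ≤ δ₀ / 8)
  have hMr : (0 : ℝ) < M := by exact_mod_cast hM
  rw [le_div_iff₀ hMr]
  have h1 : alpha515 d N c₀ δ₀ M * M ≤
      3 * Real.pi * d / 2 * weightConst d N c₀ δ₀ + c₀ * (N * latticeConst d (δ₀ / 4)) * (10 / δ₀) := by
    rwa [le_div_iff₀ hMr] at hα
  calc 3 ^ d * (latticeConst d (δ₀ / 8) * (Real.exp (δ₀ / 8) * alpha515 d N c₀ δ₀ M * γ₀⁻¹)) * M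
      = 3 ^ d * (latticeConst d (δ₀ / 8) * (Real.exp (δ₀ / 8) * γ₀⁻¹ * (alpha515 d N c₀ δ₀ M * M))) := by ring
    _ ≤ 3 ^ d * (latticeConst d (δ₀ / 8) * (Real.exp (δ₀ / 8) * γ₀⁻¹ *
        (3 * Real.pi * d / 2 * weightConst d N c₀ δ₀ + c₀ * (N * latticeConst d (δ₀ / 4)) * (10 / δ₀)))) := by
        gcongr

/-- **(5.7) BY THE PRINTED WALK ROUTE, uniform constants** (p. 597: *"The constants δ₁, c₁ are functions of δ₀, γ₀,
c₀"*): for every `(d, N, γ₀, c₀, δ₀)` there is a cube size `M` (so `c₁ = 2^{d+1}γ₀^{−1}e^{δ₀/4}`, `δ₁ = δ₀/(8M)` depend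
on `d, N, γ₀, c₀, δ₀` only) such that for EVERY finite `Λ ⊂ ℤ^d` and every `A` on `L²(Λ; ℝ^N)` with (5.6),
`|A_Λ^{−1}(x,x′)| ≤ c₁e^{−δ₁|x−x′|}`. [cite: Balaban1983RegularityDecay, (5.7) p.594; (5.21) p.596; p.597] -/
theorem concl57_walk (d N : ℕ) (hγ : 0 < γ₀) (hc : 0 ≤ c₀) (hδ : 0 < δ₀) :
    ∃ M : ℕ, 0 < M ∧ ∀ (Λ : Finset (Fin d → ℤ)) (A : Matrix (B4.Idx Λ N) (B4.Idx Λ N) ℝ),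
      B4.Hyp56 Λ A γ₀ c₀ δ₀ → ∀ p q : B4.Idx Λ N,
        |A⁻¹ p q| ≤ 2 ^ (d + 1) * γ₀⁻¹ * Real.exp (δ₀ / 4) *
          Real.exp (-(δ₀ / (8 * M) * dist (p.1 : Fin d → ℤ) (q.1 : Fin d → ℤ))) := by
  set Θ := 3 ^ d * (latticeConst d (δ₀ / 8) * (Real.exp (δ₀ / 8) * γ₀⁻¹ *
    (3 * Real.pi * d / 2 * weightConst d N c₀ δ₀ + c₀ * (N * latticeConst d (δ₀ / 4)) * (10 / δ₀)))) with hΘ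
  set M : ℕ := ⌈max (max (kR d N γ₀ c₀ δ₀) (thetaConst d N γ₀ c₀ δ₀)) (2 * Θ)⌉₊ + 5 with hMdef
  have hM5 : 5 ≤ M := by omega
  have hM0 : 0 < M := by omega
  have hMr : (0 : ℝ) < M := by exact_mod_cast hM0
  have hceil : max (max (kR d N γ₀ c₀ δ₀) (thetaConst d N γ₀ c₀ δ₀)) (2 * Θ) < M := by
    rw [hMdef]
    push_cast
    have := Nat.le_ceil (max (max (kR d N γ₀ c₀ δ₀) (thetaConst d N γ₀ c₀ δ₀)) (2 * Θ))
    linarith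
  have hMR : kR d N γ₀ c₀ δ₀ < M := lt_of_le_of_lt ((le_max_left _ _).trans (le_max_left _ _)) hceil
  have hMθ : thetaConst d N γ₀ c₀ δ₀ < M := lt_of_le_of_lt ((le_max_right _ _).trans (le_max_left _ _)) hceil
  have h2Θ : 2 * Θ < M := lt_of_le_of_lt (le_max_right _ _) hceil
  refine ⟨M, hM0, fun Λ A hA p q => ?_⟩
  set θ := 3 ^ d * (latticeConst d (δ₀ / 8) * (Real.exp (δ₀ / 8) * alpha515 d N c₀ δ₀ M * γ₀⁻¹)) with hθ
  have hθ0 : 0 ≤ θ := by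
    have := alpha515_nonneg d N hc hδ M
    have := latticeConst_nonneg d (by positivity : (0:ℝ) ≤ δ₀ / 8)
    positivity
  have hθle : θ ≤ Θ / M := thetaW_le hγ hc hδ hM0
  have hθhalf : θ ≤ 1 / 2 := by
    refine hθle.trans ?_
    rw [div_le_iff₀ hMr]
    have : 0 ≤ Θ := by
      have := (mul_nonneg hθ0 hMr.le).trans ((le_div_iff₀ hMr).mp hθle)
      exact this
    linarith
  have hθ1 : θ < 1 := by linarith
  have h := abs_inv_apply_le_of_walk hγ hc hδ hA hM5 hMR hMθ hθ1 p q
  refine h.trans ?_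
  have hinv : (1 - θ)⁻¹ ≤ 2 := by
    rw [inv_le_comm₀ (by linarith) (by norm_num)]
    linarith
  have hE := Real.exp_pos (-(δ₀ / (8 * M) * dist (p.1 : Fin d → ℤ) (q.1 : Fin d → ℤ)))
  calc 2 ^ d * γ₀⁻¹ * Real.exp (δ₀ / 4) * (1 - θ)⁻¹ *
        Real.exp (-(δ₀ / (8 * M) * dist (p.1 : Fin d → ℤ) (q.1 : Fin d → ℤ)))
      ≤ 2 ^ d * γ₀⁻¹ * Real.exp (δ₀ / 4) * 2 *
        Real.exp (-(δ₀ / (8 * M) * dist (p.1 : Fin d → ℤ) (q.1 : Fin d → ℤ))) := by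
        gcongr
    _ = _ := by ring

/-- **(5.7) AS PRINTED — *"for arbitrary Λ ⊂ Ω and for C_Λ = A_Λ^{−1}, A_Λ is an operator defined on L²(Λ) by A_Λ =
ΛAΛ. We have |C_Λ(x,x′)| ≤ c₁e^{−δ₁|x−x′|}, x, x′ ∈ Λ"* — by the walk route**: constants `c₁, δ₁ > 0` depending on
`d, N, γ₀, c₀, δ₀` only, for every finite `Ω ⊂ ℤ^d`, every `A` with (5.6) on `Ω` and EVERY `Λ ⊆ Ω` (the first clause
of `B4.Concl57_58 Ω Λ h A c₁ δ₁`; (5.6) passes to the compression `A_Λ` by `B6GOmega.hyp56_compress`).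
[cite: Balaban1983RegularityDecay, Sect. 5 Theorem (5.7) p.594; p.597] -/
theorem concl57_compress_walk (d N : ℕ) (hγ : 0 < γ₀) (hc : 0 ≤ c₀) (hδ : 0 < δ₀) :
    ∃ c₁ δ₁ : ℝ, 0 < c₁ ∧ 0 < δ₁ ∧
      ∀ (Ω Λ : Finset (Fin d → ℤ)) (h : Λ ⊆ Ω) (A : Matrix (B4.Idx Ω N) (B4.Idx Ω N) ℝ),
        B4.Hyp56 Ω A γ₀ c₀ δ₀ → ∀ p q : B4.Idx Λ N,
          |(B4.compress h A)⁻¹ p q| ≤ c₁ * Real.exp (-(δ₁ * dist (p.1 : Fin d → ℤ) (q.1 : Fin d → ℤ))) := by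
  obtain ⟨M, hM0, hM⟩ := concl57_walk d N hγ hc hδ
  have hMr : (0 : ℝ) < M := by exact_mod_cast hM0
  refine ⟨2 ^ (d + 1) * γ₀⁻¹ * Real.exp (δ₀ / 4), δ₀ / (8 * M), by positivity, by positivity, ?_⟩
  intro Ω Λ h A hA p q
  exact hM Λ (B4.compress h A) (hyp56_compress h hγ.le hc hδ.le hA) p q

end Main
end Literature.MathematicalPhysics.QuantumFieldTheory.Balaban1983to89.B4Sect5WalkDecay
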